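import Summits.QuantumFields.YangMills.Theorems.BalabanUVNodesN11CubeCoverRowOfNesting
import Summits.QuantumFields.YangMills.Theorems.AlphaInputsT3ACv3StencilGauge

/-!
# DAG node N11 — THE CUBE-COVER ROW IS TIGHT: on a torus wider than one `𝐃_1`-cube whose `𝐃_1` grid divides it, the row `hcov` of the no-expansion 𝐓-step faces FORCES
# the nesting numeric `L·M₂ ∣ M` — so the binder `hdiv` of the `_of_nesting` faces (p606678) is EXACTLY as strong as the row it replaces (A6 ∕ strictness exhibit)

HEADER — WORK-UNIT METADATA.  Cell `pub-ymgap`, YM-PLAN Track A (HUMAN RULING D-0062 ∕ D-0149 width seats), seat `pub-ymgap-dag-n11-w4` (g3; WIDTH SEAT 4 of 4 on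
NODE n11 [B14]), route `BalabanUVNodes`, item K1⁷ `StabilityBAtRecordR13SepCoPH` = stmt-QuantumFields-20542 (helper, `--kind proof --supports 20542 --as helper`, count-neutral).
[III] = [Balaban1988Convergent], [I] = [Balaban1987RG1].  Over this seat's `…N11CubeCoverRowOfNesting` (p606678: ★★ `cover_row_of_partCompat_of_nesting` — the row FROM the numeric),
node00-def-K0b's `Node00/Record12BgRowCubeGeometry` (`cubeIndices_bounds`), the cell's `AlphaInputsT3ACv3StencilGauge` (`StencilGauge.int_eq_of_cast_eq`: residues determine
representatives in `[0, T)` — reused, not restated; gate `dedup.landed` on ed.1), def-R's cube geometry (`cubeIndices`, `cubeEnl`, `cubeExt`, `unionsOfCubes`, `dCubeSide`, `DOfRecord`,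
`SeqOfRecord`), r11's `B14.Eq218Concrete.Seq.ofChain` (the index of a (2.1) chain), the torus cover `B15Eq112TorusCover.cover`.

WHY THIS FILE.  p606678 replaced the displayed row `hcov` («at every level `1 ≤ j ≤ k` and every (2.18) index `s`, `Ω_j(s) ⊆ ⋃ {L M₂ R_j-cubes of the (2.17) partition inside
`Ω_j(s)`}») of dag-n11-d's no-expansion 𝐓-step faces by ONE scalar, the nesting numeric `L·M₂ ∣ M`, given the faces' own `PartCompat₁₃`.  THIS FILE proves the CONVERSE, so the
replacement loses nothing: already the level-1 instance of `hcov` at ONE index — `Ω_1 = Λ_1 =` the `𝐃_1`-cube of index `0` (side `s = L·M·R_1`) — forces `S ∣ s` for the partition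
side `S = L²·M₂·R_1`, i.e. `L·M₂ ∣ M`, as soon as the `𝐃_1` grid divides the torus (`PartCompat₁₃ … 1`) and the torus is wider than that one cube (`s < 2·L^{m+K}`; at `s =` the
period the cube IS the torus and the cover is trivial).  The mechanism is one axis walk: the grid `S`-cube through the far corner `cover((s−1)·e₀)` starts at `S·a₀ < 2L^{m+K}` (grid cubes
start below the period), lies inside the `s`-cube, hence meets only residues `< s` along the axis and cannot wrap (the residue `2L^{m+K} − 1 ≥ s` is not in the cube) — so it is the
integer interval `[S·a₀, S·a₀ + S − 1] ⊆ [0, s − 1]` containing `s − 1`: `s = S·(a₀ + 1)`.  In particular dag-n11-d g12's located sentence (bus l.27232: K0a's `M = M₂ = 1` fails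
the cover) is the instance `L ∤ 1` of a kernel theorem, and `hcov ⟺ L·M₂ ∣ M` under the faces' structural rows.

WHAT THIS FILE PROVES (0 `sorry`, 0 `def`; nothing of Bałaban asserted).  §1 torus geometry (any `Params` with `0 < d`): `mul_cubeIndices_lt` (grid cubes start below the period) ·
★★ `dvd_of_cube_subset_iUnion_cubesIn` (`s ∣ T`, `s < T`, `0 < S`: the `s`-cube of index `0`
covered by the grid `S`-cubes inside it ⇒ `S ∣ s`).  §2 the record's letters: `zero_mem_cubeIndices` · `exists_seqOfRecord_one_cube` (a length-1 (2.18) index with `Ω_1 =` the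
`𝐃_1`-cube of index `0`; r11's `Seq.ofChain`) · ★★ `nesting_of_cover_row` (generic θ: `1 ≤ k`, `PartCompat₁₃ … 1`, the `𝐃_1`-cube narrower than the torus, the row `hcov` up to `k`
⇒ `L·M₂ ∣ M`) · ★★★ `cover_row_iff_nesting` (with p606678: under `PartCompat₁₃ … k`, `1 ≤ k`, proper torus, `hcov ⟺ L·M₂ ∣ M`) · `not_cover_row_of_not_dvd`.

HONEST FRAMING.  Helper lane of K1⁷; torus ∕ lattice arithmetic; nothing of [III]'s estimates asserted; NOT a refutation of any registered text — it certifies that a DISPLAYED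
hypothesis of dag-n11-d's faces is equivalent to the scalar that replaced it.  N11 NOT discharged; K1⁷ NOT closed; counts unmoved (typed 28∕28 · discharged 5∕27).  R4 closes only
the conditional finite-𝕋⁴ rung `BalabanLadder.UV` of one programme at fixed `ε = L^{−K}` — NOT ℝ⁴, NOT OS, NOT a mass gap, NOT Clay.  No `sorry`, `axiom`, `def`, `instance`,
`notation`.  Sources (SHAPE only): [III] (2.1) p.254, (2.5) p.255, (2.17)–(2.18) p.257; [I] (0.1) p.251.
-/

noncomputable section

open MeasureTheory
open scoped BigOperators

namespace Summit.QuantumFields.YangMills.Theorems.BalabanUVNodesN11CubeCoverRowTight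

open Literature.MathematicalPhysics.QuantumFieldTheory.Balaban1983to89 T4Continuum Node00
open B14.Eq218Concrete B14DomainGeom
open B14.Eq213MaximalDomains (cubeExt)
open B15Eq112TorusCover (cover cover_apply)
open BalabanUVNodesN11CubeCoverRowOfNesting (cover_row_of_partCompat_of_nesting pos_of_mul_dvd_sitesPerDir)

/-! ## §1  Torus geometry: a grid cube covered by finer-looking grid cubes it contains forces divisibility of the sides -/

section Geometry

variable {P : Params}

/-- **GRID CUBES START BELOW THE PERIOD**: an index of the `S`-grid has `S·a_i < sitesPerDir 0` (`a_i < ⌈T∕S⌉`). [cite: Balaban1988Convergent, (2.17) p.257 (bookkeeping)] -/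
theorem mul_cubeIndices_lt {S : ℕ} {a : Pt P.d} (ha : a ∈ cubeIndices P S) (i : Fin P.d) :
    (S : ℤ) * a i < ((P.sitesPerDir 0 : ℕ) : ℤ) := by
  simp only [cubeIndices, Fintype.mem_piFinset, Finset.mem_image, Finset.mem_range] at ha
  obtain ⟨n, hn, hna⟩ := ha i
  have hT : 0 < P.sitesPerDir 0 := Nat.pos_of_ne_zero (P.sitesPerDir_ne_zero 0)
  have hq : S * ((P.sitesPerDir 0 + S - 1) / S) ≤ P.sitesPerDir 0 + S - 1 := Nat.mul_div_le _ _
  have h1 : S * (n + 1) ≤ S * ((P.sitesPerDir 0 + S - 1) / S) := Nat.mul_le_mul_left S hn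
  have h2 : S * n < P.sitesPerDir 0 := by
    have h3 : S * (n + 1) = S * n + S := by ring
    rcases Nat.eq_zero_or_pos S with hS | hS
    · subst hS; simpa using hT
    · omega
  rw [← hna]
  exact_mod_cast h2

/-- **★★ A GRID CUBE COVERED BY THE GRID CUBES OF ANOTHER SIDE IT CONTAINS HAS A SIDE DIVISIBLE BY THAT SIDE** (`s ∣ T`, `s < T`, `0 < S`, `d ≥ 1`): if the `s`-cube of index `0` is
covered by the `S`-cubes of the grid lying inside it, then `S ∣ s`.  Axis walk through the far corner `cover((s−1)·e₀)`: its grid `S`-cube starts at `S·a₀ < T`, has all its axis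
residues `< s < T` (it lies inside the `s`-cube), so it cannot wrap and is the integer interval `[S·a₀, S·a₀+S−1] ⊆ [0, s−1]` through `s − 1`; hence `s = S·(a₀+1)`.
[cite: Balaban1988Convergent, (2.17) p.257 («partitions … compatible»); Balaban1987RG1, (0.1) p.251] -/
theorem dvd_of_cube_subset_iUnion_cubesIn (hd : 0 < P.d) {s S : ℕ} (hS : 0 < S)
    (hsT : s ∣ P.sitesPerDir 0) (hlt : s < P.sitesPerDir 0)
    (hcov : cubeEnl P s 0 0 ⊆ ⋃ a ∈ cubesIn (fun a : ↥(cubeIndices P S) => cubeEnl P S a 0) (cubeEnl P s 0 0), cubeEnl P S a 0) :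
    S ∣ s := by
  have hs : 0 < s := Nat.pos_of_ne_zero fun h => P.sitesPerDir_ne_zero 0 (Nat.eq_zero_of_zero_dvd (h ▸ hsT))
  set T : ℕ := P.sitesPerDir 0 with hTdef
  set i₀ : Fin P.d := ⟨0, hd⟩ with hi₀
  -- the far corner on the first axis and its grid `S`-cube
  set c : Pt P.d := fun i => if i = i₀ then ((s : ℤ) - 1) else 0 with hc
  have hcmem : c ∈ cubeExt s (0 : Pt P.d) ((0 * s : ℕ) : ℤ) := by
    intro i
    simp only [hc, Pi.zero_apply, mul_zero, zero_mul, Nat.cast_zero, zero_add, add_zero]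
    split_ifs <;> constructor <;> linarith [(by exact_mod_cast hs : (1 : ℤ) ≤ s)]
  have hx : cover P c ∈ cubeEnl P s 0 0 := ⟨c, hcmem, rfl⟩
  obtain ⟨a, ha, hxa⟩ := Set.mem_iUnion₂.1 (hcov hx)
  have hsub : cubeEnl P S a 0 ⊆ cubeEnl P s 0 0 := (mem_cubesIn (fun a : ↥(cubeIndices P S) => cubeEnl P S a 0) _ a).1 ha
  obtain ⟨w, hw, hwx⟩ := hxa
  have hw' : ∀ i, (S : ℤ) * (a : Pt P.d) i ≤ w i ∧ w i ≤ (S : ℤ) * (a : Pt P.d) i + S - 1 := fun i => by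
    have h := hw i
    simp only [zero_mul, Nat.cast_zero, sub_zero, add_zero] at h
    exact h
  -- the start of that cube on the axis: `0 ≤ v < T`
  set v : ℤ := (S : ℤ) * (a : Pt P.d) i₀ with hv
  have hv0 : 0 ≤ v := mul_nonneg (by positivity) (cubeIndices_bounds a.2 i₀).1
  have hvT : v < (T : ℤ) := mul_cubeIndices_lt a.2 i₀
  -- every axis value `y ∈ [v, v+S-1] ∩ [0, T)` of the cube is a residue of the `s`-cube, hence `≤ s - 1`
  have hfit : ∀ y : ℤ, v ≤ y → y ≤ v + S - 1 → 0 ≤ y → y < T → y ≤ (s : ℤ) - 1 := by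
    intro y hy1 hy2 hy0 hyT
    -- the point of the `S`-cube with axis coordinate `y`
    have hmem : Function.update w i₀ y ∈ cubeExt S (a : Pt P.d) ((0 * S : ℕ) : ℤ) := by
      intro i
      simp only [zero_mul, Nat.cast_zero, sub_zero, add_zero]
      by_cases hi : i = i₀
      · subst hi; simp only [Function.update_self]; exact ⟨hy1, by linarith⟩
      · simp only [Function.update_of_ne hi]; exact hw' i
    have hin : cover P (Function.update w i₀ y) ∈ cubeEnl P s 0 0 := hsub ⟨_, hmem, rfl⟩
    obtain ⟨z, hz, hzc⟩ := hin
    have hz0 := hz i₀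
    simp only [Pi.zero_apply, mul_zero, zero_mul, Nat.cast_zero, zero_add, add_zero, sub_zero] at hz0
    have hcoord : ((z i₀ : ℤ) : ZMod T) = ((y : ℤ) : ZMod T) := by
      have := congr_fun hzc i₀
      simpa [cover_apply, Function.update_self] using this
    have hzy : z i₀ = y := StencilGauge.int_eq_of_cast_eq (by linarith [hz0.1]) (by linarith [hz0.2, (by exact_mod_cast hlt : (s : ℤ) < T)]) hy0 hyT hcoord
    linarith [hz0.2]
  -- induction along the axis: `v + u ≤ s - 1` for all `u ≤ S - 1`
  have key : ∀ u : ℕ, u ≤ S - 1 → v + u ≤ (s : ℤ) - 1 := by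
    intro u
    induction u with
    | zero =>
      intro _
      simpa using hfit v le_rfl (by linarith [(by exact_mod_cast hS : (1 : ℤ) ≤ S)]) hv0 hvT
    | succ u ih =>
      intro hu
      have ih' := ih (by omega)
      have hsT' : (s : ℤ) < T := by exact_mod_cast hlt
      have := hfit (v + (u + 1 : ℕ)) (by push_cast; linarith) (by push_cast; omega) (by push_cast; linarith) (by push_cast; linarith)
      exact this
  have htop : v + S ≤ (s : ℤ) := by
    have := key (S - 1) le_rfl
    have hS1 : ((S - 1 : ℕ) : ℤ) = (S : ℤ) - 1 := by omega
    rw [hS1] at this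
    linarith
  -- the corner itself lies in the cube: `w i₀ = s - 1 ≤ v + S - 1`
  have hwc : w i₀ = (s : ℤ) - 1 := by
    have h1 := congr_fun hwx i₀
    simp only [cover_apply, hc] at h1
    simp only [if_true] at h1
    have hwlo : 0 ≤ w i₀ := le_trans hv0 (hw' i₀).1
    have hwhi : w i₀ < T := by linarith [(hw' i₀).2, htop, (by exact_mod_cast hlt : (s : ℤ) < T)]
    exact StencilGauge.int_eq_of_cast_eq hwlo hwhi (by linarith [(by exact_mod_cast hs : (1 : ℤ) ≤ s)]) (by linarith [(by exact_mod_cast hlt : (s : ℤ) < T)]) h1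
  have hbot : (s : ℤ) ≤ v + S := by linarith [(hw' i₀).2]
  -- conclude `s = S · (a₀ + 1)`
  have heq : (s : ℤ) = (S : ℤ) * ((a : Pt P.d) i₀ + 1) := by rw [mul_add, mul_one]; linarith
  have ha0 : 0 ≤ (a : Pt P.d) i₀ := (cubeIndices_bounds a.2 i₀).1
  obtain ⟨n, hn⟩ := Int.eq_ofNat_of_zero_le (by linarith : (0 : ℤ) ≤ (a : Pt P.d) i₀ + 1)
  refine ⟨n, ?_⟩
  have : (s : ℤ) = ((S * n : ℕ) : ℤ) := by rw [heq, hn]; push_cast; ring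
  exact_mod_cast this

end Geometry

/-! ## §2  The record's letters: the row `hcov` forces `L·M₂ ∣ M` -/

section Record

variable {F : T4Family} {N : ℕ} [NeZero N]

/-- The index `0` is an index of every grid (`⌈T∕s⌉ ≥ 1` for `s ≥ 1`). [cite: Balaban1988Convergent, (2.17) p.257 (bookkeeping)] -/
theorem zero_mem_cubeIndices (P : Params) {s : ℕ} (hs : 0 < s) : (0 : Pt P.d) ∈ cubeIndices P s := by
  have hT : 0 < P.sitesPerDir 0 := Nat.pos_of_ne_zero (P.sitesPerDir_ne_zero 0)
  unfold cubeIndices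
  rw [Fintype.mem_piFinset]
  intro i
  rw [Finset.mem_image]
  exact ⟨0, Finset.mem_range.mpr (Nat.div_pos (by omega) hs), by simp⟩

variable (θ : Stage13HParams F N) (p : B12.RunParams)

/-- **A LENGTH-1 (2.18) INDEX WITH `Ω_1 = Λ_1 =` THE `𝐃_1`-CUBE OF INDEX `0`** (side `L·M·R_1`; the (2.1) chain conditions at length 1 are `Λ_1 ⊆ Ω_1` only; r11's `Seq.ofChain`).
[cite: Balaban1988Convergent, (2.1) p.254, (2.18) p.257 (bookkeeping)] -/
theorem exists_seqOfRecord_one_cube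
    (hs : 0 < dCubeSide (F.P p.K).L θ.τ9.M (RkOfRecord (F.P p.K).L θ.ν.r (gOfRecord₁₃ F N θ.toStage13Params p 1)) 1) :
    ∃ s : SeqOfRecord F θ.ν θ.τ9.M (gOfRecord₁₃ F N θ.toStage13Params p) p.K 1,
      s.Ω 1 = cubeEnl (F.P p.K) (dCubeSide (F.P p.K).L θ.τ9.M (RkOfRecord (F.P p.K).L θ.ν.r (gOfRecord₁₃ F N θ.toStage13Params p 1)) 1) 0 0 := by
  set sd := dCubeSide (F.P p.K).L θ.τ9.M (RkOfRecord (F.P p.K).L θ.ν.r (gOfRecord₁₃ F N θ.toStage13Params p 1)) 1 with hsd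
  have hD : cubeEnl (F.P p.K) sd 0 0 ∈ DOfRecord F θ.ν θ.τ9.M (gOfRecord₁₃ F N θ.toStage13Params p) p.K 1 := by
    show cubeEnl (F.P p.K) sd 0 0 ∈ unionsOfCubes (F.P p.K) sd
    refine ⟨{0}, ?_, (Finset.set_biUnion_singleton (0 : Pt (F.P p.K).d) (fun a => cubeEnl (F.P p.K) sd a 0)).symm⟩
    intro a ha
    rw [Finset.mem_singleton] at ha
    subst ha
    exact zero_mem_cubeIndices (F.P p.K) hs
  have hch : Chain21 (DOfRecord F θ.ν θ.τ9.M (gOfRecord₁₃ F N θ.toStage13Params p) p.K) 1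
      (fun _ => cubeEnl (F.P p.K) sd 0 0) (fun _ => cubeEnl (F.P p.K) sd 0 0) :=
    { memΩ := fun j h1 hj => by obtain rfl : j = 1 := le_antisymm hj h1; exact hD
      memΛ := fun j h1 hj => by obtain rfl : j = 1 := le_antisymm hj h1; exact hD
      Λ_subset := fun _ _ _ => subset_rfl
      Ω_succ_subset := fun j h1 hj => by omega }
  exact ⟨Seq.ofChain _ _ hch, Seq.ofChain_Ω hch le_rfl le_rfl⟩

/-- **★★ THE CUBE-COVER ROW FORCES THE NESTING NUMERIC**: if the `𝐃_1` grid divides the torus (`PartCompat₁₃ … 1`), the `𝐃_1`-cube is narrower than the torus, and dag-n11-d's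
row `hcov` holds up to some `k ≥ 1`, then `L·M₂ ∣ M` — the level-1 instance at the one-cube index gives `L²·M₂·R_1 ∣ L·M·R_1` (§1), and `L·R_1 > 0` cancels.
[cite: Balaban1988Convergent, (2.1) p.254, (2.5) p.255, (2.17)–(2.18) p.257; Balaban1987RG1, (0.1) p.251] -/
theorem nesting_of_cover_row {k : ℕ} (hk1 : 1 ≤ k) (hPC : PartCompat₁₃ F N θ.toStage13Params p 1)
    (hsmall : dCubeSide (F.P p.K).L θ.τ9.M (RkOfRecord (F.P p.K).L θ.ν.r (gOfRecord₁₃ F N θ.toStage13Params p 1)) 1 < (F.P p.K).sitesPerDir 0)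
    (hcov : ∀ j, 1 ≤ j → j ≤ k → ∀ s : SeqOfRecord F θ.ν θ.τ9.M (gOfRecord₁₃ F N θ.toStage13Params p) p.K j,
      s.Ω j ⊆ ⋃ a ∈ cubesIn (fun a : ↥(cubeIndices (F.P p.K) (cubeSide (F.P p.K).L θ.ν.M₂ (RkOfRecord (F.P p.K).L θ.ν.r (gOfRecord₁₃ F N θ.toStage13Params p j)) j)) =>
          cubeEnl (F.P p.K) (cubeSide (F.P p.K).L θ.ν.M₂ (RkOfRecord (F.P p.K).L θ.ν.r (gOfRecord₁₃ F N θ.toStage13Params p j)) j) a 0) (s.Ω j),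
        cubeEnl (F.P p.K) (cubeSide (F.P p.K).L θ.ν.M₂ (RkOfRecord (F.P p.K).L θ.ν.r (gOfRecord₁₃ F N θ.toStage13Params p j)) j) a 0) :
    (F.P p.K).L * θ.ν.M₂ ∣ θ.τ9.M := by
  set R := RkOfRecord (F.P p.K).L θ.ν.r (gOfRecord₁₃ F N θ.toStage13Params p 1) with hR
  have hsT : dCubeSide (F.P p.K).L θ.τ9.M R 1 ∣ (F.P p.K).sitesPerDir 0 := hPC 1 le_rfl le_rfl
  have hpos : 0 < dCubeSide (F.P p.K).L θ.τ9.M R 1 :=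
    Nat.pos_of_ne_zero fun h => (F.P p.K).sitesPerDir_ne_zero 0 (Nat.eq_zero_of_zero_dvd (h ▸ hsT))
  -- `L`, `M`, `R` are positive (their product is)
  have hL : 0 < (F.P p.K).L := by show 0 < F.L; have := F.hL11; omega
  have hRpos : 0 < R := Nat.pos_of_ne_zero fun h => by simp [dCubeSide, h] at hpos
  obtain ⟨s, hsΩ⟩ := exists_seqOfRecord_one_cube θ p hpos
  have h1 := hcov 1 le_rfl hk1 s
  rw [hsΩ] at h1
  -- the partition side at level 1 is positive unless `M₂ = 0`, in which case the cover of the nonempty cube by no cubes fails; handle via §1 with `0 < S`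
  rcases Nat.eq_zero_or_pos θ.ν.M₂ with hM₂ | hM₂
  · -- `S = 0`: every grid "cube" is the image of the box `[0, -1]^d = ∅`, so the union is empty while the `𝐃_1`-cube is not
    exfalso
    have hne : (cubeEnl (F.P p.K) (dCubeSide (F.P p.K).L θ.τ9.M R 1) 0 0).Nonempty :=
      ⟨_, B15Claim189CubePin.mem_cubeEnl_cubeOfSite _ hpos (cover (F.P p.K) 0) |> fun h => by
        -- any site lies in the cube of its own index; use the site `cover 0`, whose index is `0`
        exact ⟨(0 : Pt (F.P p.K).d), fun i => by
          simp only [Pi.zero_apply, mul_zero, zero_mul, Nat.cast_zero, zero_add, add_zero, sub_zero]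
          exact ⟨le_rfl, by linarith [(by exact_mod_cast hpos : (1 : ℤ) ≤ dCubeSide (F.P p.K).L θ.τ9.M R 1)]⟩, rfl⟩⟩
    obtain ⟨x, hx⟩ := hne
    obtain ⟨a, -, hxa⟩ := Set.mem_iUnion₂.1 (h1 hx)
    obtain ⟨z, hz, -⟩ := hxa
    have hz0 := hz ⟨0, by simp⟩
    simp only [cubeSide, hM₂, mul_zero, zero_mul, Nat.cast_zero, sub_zero, add_zero, zero_sub] at hz0
    linarith [hz0.1, hz0.2]
  have hS : 0 < cubeSide (F.P p.K).L θ.ν.M₂ R 1 := by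
    unfold cubeSide; positivity
  have hdvd : cubeSide (F.P p.K).L θ.ν.M₂ R 1 ∣ dCubeSide (F.P p.K).L θ.τ9.M R 1 :=
    dvd_of_cube_subset_iUnion_cubesIn (by simp) hS hsT hsmall h1
  -- cancel `L · R`: `L² M₂ R ∣ L M R ⇒ L M₂ ∣ M`
  unfold cubeSide dCubeSide at hdvd
  have h' : ((F.P p.K).L * θ.ν.M₂) * ((F.P p.K).L * R) ∣ θ.τ9.M * ((F.P p.K).L * R) := by
    have e1 : (F.P p.K).L ^ (1 + 1) * θ.ν.M₂ * R = ((F.P p.K).L * θ.ν.M₂) * ((F.P p.K).L * R) := by ring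
    have e2 : (F.P p.K).L ^ 1 * θ.τ9.M * R = θ.τ9.M * ((F.P p.K).L * R) := by ring
    rw [← e1, ← e2]; exact hdvd
  exact (Nat.mul_dvd_mul_iff_right (Nat.mul_pos hL hRpos)).1 h'

/-- **★★★ THE CUBE-COVER ROW ⟺ THE NESTING NUMERIC** under the faces' structural rows (`1 ≤ k`, `PartCompat₁₃ … k`, the `𝐃_1`-cube narrower than the torus): with p606678's
`cover_row_of_partCompat_of_nesting`. [cite: Balaban1988Convergent, (2.1) p.254, (2.5) p.255, (2.17)–(2.18) p.257; Balaban1987RG1, (0.1) p.251] -/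
theorem cover_row_iff_nesting {k : ℕ} (hk1 : 1 ≤ k) (hPC : PartCompat₁₃ F N θ.toStage13Params p k)
    (hsmall : dCubeSide (F.P p.K).L θ.τ9.M (RkOfRecord (F.P p.K).L θ.ν.r (gOfRecord₁₃ F N θ.toStage13Params p 1)) 1 < (F.P p.K).sitesPerDir 0) :
    (∀ j, 1 ≤ j → j ≤ k → ∀ s : SeqOfRecord F θ.ν θ.τ9.M (gOfRecord₁₃ F N θ.toStage13Params p) p.K j,
      s.Ω j ⊆ ⋃ a ∈ cubesIn (fun a : ↥(cubeIndices (F.P p.K) (cubeSide (F.P p.K).L θ.ν.M₂ (RkOfRecord (F.P p.K).L θ.ν.r (gOfRecord₁₃ F N θ.toStage13Params p j)) j)) =>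
          cubeEnl (F.P p.K) (cubeSide (F.P p.K).L θ.ν.M₂ (RkOfRecord (F.P p.K).L θ.ν.r (gOfRecord₁₃ F N θ.toStage13Params p j)) j) a 0) (s.Ω j),
        cubeEnl (F.P p.K) (cubeSide (F.P p.K).L θ.ν.M₂ (RkOfRecord (F.P p.K).L θ.ν.r (gOfRecord₁₃ F N θ.toStage13Params p j)) j) a 0) ↔
    (F.P p.K).L * θ.ν.M₂ ∣ θ.τ9.M :=
  ⟨fun h => nesting_of_cover_row θ p hk1 (hPC.of_le hk1) hsmall h, fun hdiv => cover_row_of_partCompat_of_nesting θ p hdiv hPC⟩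

/-- **NO NESTING, NO COVER** (contrapositive; K0a's `M = M₂ = 1` numerics: `L ∤ 1` for `L ≥ 2` — dag-n11-d g12's located sentence as a theorem).
[cite: Balaban1988Convergent, (2.17) p.257 (bookkeeping)] -/
theorem not_cover_row_of_not_dvd {k : ℕ} (hk1 : 1 ≤ k) (hPC : PartCompat₁₃ F N θ.toStage13Params p 1)
    (hsmall : dCubeSide (F.P p.K).L θ.τ9.M (RkOfRecord (F.P p.K).L θ.ν.r (gOfRecord₁₃ F N θ.toStage13Params p 1)) 1 < (F.P p.K).sitesPerDir 0)
    (hndvd : ¬ (F.P p.K).L * θ.ν.M₂ ∣ θ.τ9.M) :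
    ¬ ∀ j, 1 ≤ j → j ≤ k → ∀ s : SeqOfRecord F θ.ν θ.τ9.M (gOfRecord₁₃ F N θ.toStage13Params p) p.K j,
      s.Ω j ⊆ ⋃ a ∈ cubesIn (fun a : ↥(cubeIndices (F.P p.K) (cubeSide (F.P p.K).L θ.ν.M₂ (RkOfRecord (F.P p.K).L θ.ν.r (gOfRecord₁₃ F N θ.toStage13Params p j)) j)) =>
          cubeEnl (F.P p.K) (cubeSide (F.P p.K).L θ.ν.M₂ (RkOfRecord (F.P p.K).L θ.ν.r (gOfRecord₁₃ F N θ.toStage13Params p j)) j) a 0) (s.Ω j),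
        cubeEnl (F.P p.K) (cubeSide (F.P p.K).L θ.ν.M₂ (RkOfRecord (F.P p.K).L θ.ν.r (gOfRecord₁₃ F N θ.toStage13Params p j)) j) a 0 :=
  fun h => hndvd (nesting_of_cover_row θ p hk1 hPC hsmall h)

end Record

end Summit.QuantumFields.YangMills.Theorems.BalabanUVNodesN11CubeCoverRowTight

end
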